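/-
Copyright (c) 2026 the pub-hodgecm-mathlib formalisation cell (harness21).  Prover seat hodgecm-mathlib-K2E5-p17 (g9), Track B «K2-LIT»,
#184♮ = hLiu418 = `stmt-HodgeConjecture-24832`; socket #41 — the POLE-SET-PINNED siblings of ★ Φ9 ∕ ★ edition 1 ∕ ★ edition 3b (LEAD F0P6-plan (g14) BATCH #121 (2)
seam question (Q-P), road (i); desk answer 2026-09-04T23:1xZ).  THEOREMS ONLY; NO `Lines` import.
-/
import Summits.HodgeConjecture.HodgeConjecture.Theorems.K2LiuSiegelEisensteinContinuationTopKinds   -- ★ ed. 3∕3b (this lineage) ⊇ ★ ed. 1∕2 `…ContinuationTop` ⊇ ★ Φ9 `K2LiuSiegelEisensteinAssembly`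
import HarnessLib

/-!
# Crux `HLiu418`, socket #41 — THE POLE SET PINNED: siblings of ★ Φ9 `exists_continuation_package_of_term_packages`, ★ edition 1 `siegelEisensteinContinuation_of_rows`
# and ★ edition 3b `siegelEisensteinContinuation_of_kinds_fixedCarrier` that conclude `∃ Es, …` for the GIVEN pole set `P` instead of `∃ P Es, …`

Cell `hodgecm-mathlib`, crux item hLiu418 = `stmt-HodgeConjecture-24832` (helper lane until the typist's tie; count-neutral).

WHY (LEAD F0P6-plan (g14) BATCH #121 (2), seam (Q-P)).  Socket #41 concludes `∃ P Es, (A1) ∧ … ∧ (A5)` with clause (A4) `Es s h = (∏_{p∈P}(s−p))·E^Δ(h; f_s)` on `{n∕2 < re s}`;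
the HOL-½′ payer of the #42F′ face (★ p862874 `K2LiuResidueZeroRemovable.exists_continuation_of_eq_prod_singleton_mul`: from `Es ½ = 0` and (A4) AT `P = {½}` a continuation of
`E^Δ` itself, holomorphic on all of `{0 < re}`) needs the pole set PINNED — from `∃ P` nothing follows about the other `p ∈ P ∩ {0 < re}`.  The #41 TOP (★ ed. 16∕17∕18) DOES build
every kind package at `P := {½}` and the ONLY `∃ P` packing in the whole chain is the last line of ★ Φ9 (`exact ⟨P, Es, h1, h2, h3, h4, h5⟩` over ★ Φ9-core
`exists_package_of_term_packages`, which is `P`-generic).  THIS FILE re-concludes the three links of the chain BEFORE that packing, proofs otherwise verbatim: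
* §1 `exists_continuation_package_of_term_packages_poleSet` — ★ Φ9 for the binder `P`: `∃ Es, (A1) ∧ (A2) ∧ (A3) ∧ (A4 at P) ∧ (A5)`.
* §2 `siegelEisensteinContinuation_of_rows_poleSet` — ★ edition 1 for the binder `P` (★ Φ1's `heq` via ★ `hasSum_termPackages`, then §1).
* §3 `siegelEisensteinContinuation_of_kinds_fixedCarrier_poleSet` — ★ edition 3b for the binder `P` (the three-kind dispatch, ★ `majorant_of_kinds`, ★ `growth_of_kinds`, then §2).
The #41 TOP ED. 19 calls §3 at `P := {½}` and concludes `(A4)` as `Es s h = (∏ p ∈ ({(1∕2 : ℂ)} : Finset ℂ), (s − p)) * E^Δ(h; f_s)` — the `heq` bytes ★ p862874 eats — and the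
socket form follows from it by `⟨{½}, Es, …⟩`.
Sources: [MoeglinWaldspurger1995, II.1.7, IV.1.8–IV.1.11]; [Tan1999, §1 Main Theorem; §4 Props. 4.1, 4.4, 4.8]; [KudlaRallis1994, §1–§2]; [Liu2021, Lem. B.10 (2), B.12].
HONEST LABEL.  Count-neutral helper until tied; `HC_CM` is proved only modulo the 7 printed citations (2 remaining named inputs: hLiu418 = `stmt-HodgeConjecture-24832`,
h413 = `stmt-HodgeConjecture-24833`) until rung 0 closes.
-/

set_option autoImplicit false
set_option linter.dupNamespace false -- the mandated namespace repeats `HodgeConjecture.HodgeConjecture`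

noncomputable section

open scoped Matrix Topology ENNReal NNReal BigOperators
open NumberField IsDedekindDomain MeasureTheory Filter Set Metric
open Literature.NumberTheory.Automorphic Literature.NumberTheory.GaloisRepresentations
open Literature.NumberTheory.GelbartRogawski1991 Literature.NumberTheory.GelbartRogawski1991.GRConstruction
open Literature.NumberTheory.K2Lit.SiegelDoubled Literature.MeasureTheory.Group
open Literature.NumberTheory.Automorphic.IdeleClassGroup

namespace Summit.HodgeConjecture.HodgeConjecture.Cruxes.HLiu418.K2LiuSiegelEisensteinContinuationPoleSet

open K2LiuSiegelUnipotentFourierDefs K2LiuSiegelEisensteinContinuationTop K2LiuSiegelEisensteinContinuationTopKinds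
open K2LiuSiegelEisensteinAssemblyCore (exists_package_of_term_packages)
open K2LiuSiegelEisensteinDoubledLeftInvariant (siegelEisensteinDoubledLeftInvariant)
open K2LiuContinuationPackageAlgebra (exists_height_floor)

/-! ## §1 ★ Φ9 with the pole set pinned -/

section Phi9

variable (L : Type) [Field L] [NumberField L] [IsCMField L] {N M n : ℕ} (e : Fin N × Fin M ≃ Fin n)
  (dV : Fin N → L) (hdV : ∀ i, IsCMField.complexConj L (dV i) = dV i)
  (dW : Fin M → L) (hdW : ∀ i, IsCMField.complexConj L (dW i) = dW i)

/-- **Φ9 WITH THE POLE SET PINNED.**  As ★ `K2LiuSiegelEisensteinAssembly.exists_continuation_package_of_term_packages` (term packages `Ec i` holomorphic on `{0 < re}`, continuous in `h`,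
summing to `(∏_{p∈P}(s−p))·E^Δ(h; f_s)` on `{n∕2 < re}`, one locally uniform summable majorant, summed growth), but concluding for the GIVEN `P`: `∃ Es`, (A1) holomorphy,
(A2) continuity, (A3) left `H(L⁺)`-invariance, **(A4) `Es s h = (∏_{p∈P}(s−p))·E^Δ(h; f_s)` on `{n∕2 < re}` for THIS `P`**, (A5) growth (★ Φ9-core `exists_package_of_term_packages`;
(A3)'s input on the half-plane is ★ #10b). [cite: MoeglinWaldspurger1995, IV.1.8–IV.1.11] [cite: Tan1999, §1; §4 Prop. 4.8] [cite: Liu2021, Lem. B.10 (2) p. 102] -/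
theorem exists_continuation_package_of_term_packages_poleSet (χ : HeckeCharacter L) (f : ℂ → HA L e dV hdV dW hdW → ℂ)
    (hf : ∀ s : ℂ, IsSiegelDeltaSection L e dV hdV dW hdW χ s (f s)) (P : Finset ℂ) {ι : Type*} (Ec : ι → ℂ → HA L e dV hdV dW hdW → ℂ)
    (hd : ∀ i (h : HA L e dV hdV dW hdW), DifferentiableOn ℂ (fun s => Ec i s h) {s : ℂ | 0 < s.re})
    (hc : ∀ i (s : ℂ), 0 < s.re → Continuous (Ec i s))
    (heq : ∀ (s : ℂ) (h : HA L e dV hdV dW hdW), (n : ℝ) / 2 < s.re →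
      HasSum (fun i => Ec i s h) ((∏ p ∈ P, (s - p)) * eisensteinFamilyDelta L e dV hdV dW hdW f s h))
    (hmaj : ∀ z : ℂ, 0 < z.re → ∀ h₀ : HA L e dV hdV dW hdW, ∃ r > (0 : ℝ), ∃ V ∈ 𝓝 h₀, ∃ m : ι → ℝ, Summable m ∧
      ∀ s : ℂ, dist s z < r → ∀ h ∈ V, ∀ i, ‖Ec i s h‖ ≤ m i)
    (hgrowth : ∀ z : ℂ, 0 < z.re → ∃ C A r : ℝ, 0 < r ∧ ∀ s : ℂ, dist s z < r → ∀ h : HA L e dV hdV dW hdW,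
      ∑' i, ‖Ec i s h‖ ≤ C * adelicHeightGL (n + n) L (h : GL (Fin (n + n)) (AdeleRing (𝓞 L) L)) ^ A) :
    ∃ Es : ℂ → HA L e dV hdV dW hdW → ℂ,
      (∀ h : HA L e dV hdV dW hdW, DifferentiableOn ℂ (fun s => Es s h) {s : ℂ | 0 < s.re}) ∧
      (∀ s : ℂ, 0 < s.re → Continuous (Es s)) ∧
      (∀ s : ℂ, 0 < s.re → ∀ (γ : ratH L e dV hdV dW hdW) (h : HA L e dV hdV dW hdW),
        Es s ((γ : HA L e dV hdV dW hdW) * h) = Es s h) ∧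
      (∀ (s : ℂ) (h : HA L e dV hdV dW hdW), (n : ℝ) / 2 < s.re →
        Es s h = (∏ p ∈ P, (s - p)) * eisensteinFamilyDelta L e dV hdV dW hdW f s h) ∧
      (∀ z : ℂ, 0 < z.re → ∃ C A r : ℝ, 0 < r ∧ ∀ s : ℂ, dist s z < r → ∀ h : HA L e dV hdV dW hdW,
        ‖Es s h‖ ≤ C * adelicHeightGL (n + n) L (h : GL (Fin (n + n)) (AdeleRing (𝓞 L) L)) ^ A) := by
  -- (A3) input on the convergence half-plane: ★ #10b
  have hE : ∀ (γ : ratH L e dV hdV dW hdW) (s : ℂ) (h : HA L e dV hdV dW hdW), (n : ℝ) / 2 < s.re →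
      eisensteinFamilyDelta L e dV hdV dW hdW f s ((γ : HA L e dV hdV dW hdW) * h) = eisensteinFamilyDelta L e dV hdV dW hdW f s h :=
    fun γ s h _ => siegelEisensteinDoubledLeftInvariant L e dV hdV dW hdW χ s (f s) (hf s) γ h
  obtain ⟨Es, h1, h2, h3, h4, h5⟩ := exists_package_of_term_packages (0 : ℝ) ((n : ℝ) / 2) (eisensteinFamilyDelta L e dV hdV dW hdW f) P Ec
    hd hc heq hmaj (fun h : HA L e dV hdV dW hdW => adelicHeightGL (n + n) L (h : GL (Fin (n + n)) (AdeleRing (𝓞 L) L))) hgrowth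
    (fun (γ : ratH L e dV hdV dW hdW) (h : HA L e dV hdV dW hdW) => (γ : HA L e dV hdV dW hdW) * h) hE (by positivity)
  exact ⟨Es, h1, h2, h3, h4, h5⟩

end Phi9

/-! ## §2 ★ edition 1 with the pole set pinned -/

section Top1

/-- **EDITION 1 WITH THE POLE SET PINNED.**  As ★ `K2LiuSiegelEisensteinContinuationTop.siegelEisensteinContinuation_of_rows` (socket binders; Fourier carrier `(νN, β)`; a pole set
`P`; lattice-indexed term packages `Ec S` with (i)(ii), the coefficient identity (iv) at `P`, ★ Φ9's majorant and summed growth), but concluding for THIS `P`: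
`∃ Es, (A1) ∧ (A2) ∧ (A3) ∧ (A4 at P) ∧ (A5)` (★ Φ1 via ★ `hasSum_termPackages`, then §1). [cite: Tan1999, §1 Main Theorem; §4 Props. 4.1, 4.4, 4.8]
[cite: MoeglinWaldspurger1995, II.1.7, IV.1.8–IV.1.11] [cite: Liu2021, Lem. B.10 (2), B.12] -/
theorem siegelEisensteinContinuation_of_rows_poleSet
    (L : Type) [Field L] [NumberField L] [IsCMField L] {n : ℕ} (e : Fin 2 × Fin 1 ≃ Fin n)
    (dV : Fin 2 → L) (hdV : ∀ i, IsCMField.complexConj L (dV i) = dV i) (hdV0 : ∀ i, dV i ≠ 0)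
    (dW : Fin 1 → L) (hdW : ∀ i, IsCMField.complexConj L (dW i) = dW i) (hdW0 : ∀ i, dW i ≠ 0)
    (lam : IdeleClassGroup L →ₜ* Circle) (_hlam : IsConjugateSymplectic L lam) (_hw : HasWeight L lam 1)
    (𝒦 : IwasawaDatum L e dV hdV dW hdW) (_h𝒦 : 𝒦.IsStd) (f : ℂ → HA L e dV hdV dW hdW → ℂ)
    (hstd : IsStandardSectionFamily 𝒦 (toHeckeCharacter L lam⁻¹) f) (hcont : ∀ s, Continuous (f s))
    [MeasurableSpace (unipDelta L e dV hdV dW hdW)] [BorelSpace (unipDelta L e dV hdV dW hdW)]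
    (νN : Measure (unipDelta L e dV hdV dW hdW)) [νN.IsMulLeftInvariant]
    (β : unipDelta L e dV hdV dW hdW → ℝ≥0∞) (hβ : IsCoveringWeight (unipDeltaRat L e dV hdV dW hdW) β)
    (hβ0 : ∫⁻ u, β u ∂νN ≠ 0) (hβtop : ∫⁻ u, β u ∂νN ≠ ∞) (P : Finset ℂ)
    (Ec : skewMatrices ((IsCMField.complexConj L : L ≃ₐ[Fp L] L) : L →+* L) ((gramR L e dV hdV dW hdW).map (algebraMap (Fp L) L)) → ℂ → HA L e dV hdV dW hdW → ℂ)
    (hd : ∀ S (h : HA L e dV hdV dW hdW), DifferentiableOn ℂ (fun s => Ec S s h) {s : ℂ | 0 < s.re})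
    (hc : ∀ S (s : ℂ), 0 < s.re → Continuous (Ec S s))
    (hcoef : ∀ (S : skewMatrices ((IsCMField.complexConj L : L ≃ₐ[Fp L] L) : L →+* L) ((gramR L e dV hdV dW hdW).map (algebraMap (Fp L) L)))
      (s : ℂ) (h : HA L e dV hdV dW hdW), (n : ℝ) / 2 < s.re →
        Ec S s h = (∏ p ∈ P, (s - p)) * fourierCoeffDelta L e dV hdV dW hdW νN β (S : Matrix (Fin n) (Fin n) L) (eisensteinFamilyDelta L e dV hdV dW hdW f s) h)
    (hmaj : ∀ z : ℂ, 0 < z.re → ∀ h₀ : HA L e dV hdV dW hdW, ∃ r > (0 : ℝ), ∃ V ∈ 𝓝 h₀,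
      ∃ m : skewMatrices ((IsCMField.complexConj L : L ≃ₐ[Fp L] L) : L →+* L) ((gramR L e dV hdV dW hdW).map (algebraMap (Fp L) L)) → ℝ, Summable m ∧
        ∀ s : ℂ, dist s z < r → ∀ h ∈ V, ∀ S, ‖Ec S s h‖ ≤ m S)
    (hgrowth : ∀ z : ℂ, 0 < z.re → ∃ C A r : ℝ, 0 < r ∧ ∀ s : ℂ, dist s z < r → ∀ h : HA L e dV hdV dW hdW,
      ∑' S, ‖Ec S s h‖ ≤ C * adelicHeightGL (n + n) L (h : GL (Fin (n + n)) (AdeleRing (𝓞 L) L)) ^ A) :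
    ∃ Es : ℂ → HA L e dV hdV dW hdW → ℂ,
      (∀ h : HA L e dV hdV dW hdW, DifferentiableOn ℂ (fun s => Es s h) {s : ℂ | 0 < s.re}) ∧
      (∀ s : ℂ, 0 < s.re → Continuous (Es s)) ∧
      (∀ s : ℂ, 0 < s.re → ∀ (γ : ratH L e dV hdV dW hdW) (h : HA L e dV hdV dW hdW),
        Es s ((γ : HA L e dV hdV dW hdW) * h) = Es s h) ∧
      (∀ (s : ℂ) (h : HA L e dV hdV dW hdW), (n : ℝ) / 2 < s.re →
        Es s h = (∏ p ∈ P, (s - p)) * eisensteinFamilyDelta L e dV hdV dW hdW f s h) ∧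
      (∀ z : ℂ, 0 < z.re → ∃ C A r : ℝ, 0 < r ∧ ∀ s : ℂ, dist s z < r → ∀ h : HA L e dV hdV dW hdW,
        ‖Es s h‖ ≤ C * adelicHeightGL (n + n) L (h : GL (Fin (n + n)) (AdeleRing (𝓞 L) L)) ^ A) := by
  have hχ : (toHeckeCharacter L lam⁻¹).IsUnitary := isUnitary_toHeckeCharacter L lam⁻¹
  -- ★ Φ9's `heq` from ★ Φ1, with the pointwise summable bound read off the majorant at `(s, h)`
  have heq : ∀ (s : ℂ) (h : HA L e dV hdV dW hdW), (n : ℝ) / 2 < s.re →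
      HasSum (fun S => Ec S s h) ((∏ p ∈ P, (s - p)) * eisensteinFamilyDelta L e dV hdV dW hdW f s h) := by
    intro s h hs
    have hs0 : 0 < s.re := lt_of_le_of_lt (by positivity) hs
    refine hasSum_termPackages L e dV hdV dW hdW hdV0 hdW0 νN hβ hβ0 hβtop hχ hstd.1.1 hcont P Ec hcoef hs h fun _ => ?_
    obtain ⟨r, hr, V, hV, m, hm, hle⟩ := hmaj s hs0 h
    exact ⟨m, hm, fun S => hle s (by rw [dist_self]; exact hr) h (mem_of_mem_nhds hV) S⟩
  exact exists_continuation_package_of_term_packages_poleSet L e dV hdV dW hdW (toHeckeCharacter L lam⁻¹) f hstd.1.1 P Ec hd hc heq hmaj hgrowth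

end Top1

/-! ## §3 ★ edition 3b with the pole set pinned -/

section Top3b

open Classical in
/-- **EDITION 3b WITH THE POLE SET PINNED.**  As ★ `K2LiuSiegelEisensteinContinuationTopKinds.siegelEisensteinContinuation_of_kinds_fixedCarrier` (the three kinds of Fourier index over a
FIXED carrier `(νN, β)`: the constant-term package `Ec₀`, the rank-one packages `Ec₁ S`, the Whittaker packages `EcW S`, each with (i)(ii), its coefficient identity at the pole set `P`,
majorant and growth), but concluding for THIS `P`: `∃ Es, (A1) ∧ (A2) ∧ (A3) ∧ (A4 at P) ∧ (A5)` — the dispatch `𝟙_{S=0}·Ec₀ + Ec₁ S + EcW S`, ★ `majorant_of_kinds`, ★ `growth_of_kinds`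
under ★ `exists_height_floor`, then §2. [cite: Tan1999, §4 Props. 4.1, 4.4, 4.8] [cite: KudlaRallis1994, §1–§2] [cite: MoeglinWaldspurger1995, II.1.7, IV.1.8–IV.1.11] -/
theorem siegelEisensteinContinuation_of_kinds_fixedCarrier_poleSet
    (L : Type) [Field L] [NumberField L] [IsCMField L] {n : ℕ} (e : Fin 2 × Fin 1 ≃ Fin n)
    (dV : Fin 2 → L) (hdV : ∀ i, IsCMField.complexConj L (dV i) = dV i) (hdV0 : ∀ i, dV i ≠ 0)
    (dW : Fin 1 → L) (hdW : ∀ i, IsCMField.complexConj L (dW i) = dW i) (hdW0 : ∀ i, dW i ≠ 0)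
    (lam : IdeleClassGroup L →ₜ* Circle) (hlam : IsConjugateSymplectic L lam) (hw : HasWeight L lam 1)
    (𝒦 : IwasawaDatum L e dV hdV dW hdW) (h𝒦 : 𝒦.IsStd) (f : ℂ → HA L e dV hdV dW hdW → ℂ)
    (hstd : IsStandardSectionFamily 𝒦 (toHeckeCharacter L lam⁻¹) f) (hcont : ∀ s, Continuous (f s))
    [MeasurableSpace (unipDelta L e dV hdV dW hdW)] [BorelSpace (unipDelta L e dV hdV dW hdW)]
    (νN : Measure (unipDelta L e dV hdV dW hdW)) [νN.IsMulLeftInvariant]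
    (β : unipDelta L e dV hdV dW hdW → ℝ≥0∞) (hβ : IsCoveringWeight (unipDeltaRat L e dV hdV dW hdW) β)
    (hβ0 : ∫⁻ u, β u ∂νN ≠ 0) (hβtop : ∫⁻ u, β u ∂νN ≠ ∞) (P : Finset ℂ)
    (Ec₀ : ℂ → HA L e dV hdV dW hdW → ℂ)
    (hd₀ : ∀ h : HA L e dV hdV dW hdW, DifferentiableOn ℂ (fun s => Ec₀ s h) {s : ℂ | 0 < s.re})
    (hc₀ : ∀ s : ℂ, 0 < s.re → Continuous (Ec₀ s))
    (hcoef₀ : ∀ (s : ℂ) (h : HA L e dV hdV dW hdW), (n : ℝ) / 2 < s.re →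
      Ec₀ s h = (∏ p ∈ P, (s - p)) * fourierCoeffDelta L e dV hdV dW hdW νN β 0 (eisensteinFamilyDelta L e dV hdV dW hdW f s) h)
    (hbd₀ : ∀ z : ℂ, 0 < z.re → ∀ h₀ : HA L e dV hdV dW hdW, ∃ r > (0 : ℝ), ∃ V ∈ 𝓝 h₀, ∃ Mb : ℝ, ∀ s : ℂ, dist s z < r → ∀ h ∈ V, ‖Ec₀ s h‖ ≤ Mb)
    (hgr₀ : ∀ z : ℂ, 0 < z.re → ∃ C A r : ℝ, 0 < r ∧ ∀ s : ℂ, dist s z < r → ∀ h : HA L e dV hdV dW hdW,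
      ‖Ec₀ s h‖ ≤ C * adelicHeightGL (n + n) L (h : GL (Fin (n + n)) (AdeleRing (𝓞 L) L)) ^ A)
    (Ec₁ : skewMatrices ((IsCMField.complexConj L : L ≃ₐ[Fp L] L) : L →+* L) ((gramR L e dV hdV dW hdW).map (algebraMap (Fp L) L)) → ℂ → HA L e dV hdV dW hdW → ℂ)
    (h1off : ∀ S : skewMatrices ((IsCMField.complexConj L : L ≃ₐ[Fp L] L) : L →+* L) ((gramR L e dV hdV dW hdW).map (algebraMap (Fp L) L)), ¬ ((S : Matrix (Fin n) (Fin n) L) ≠ 0 ∧ (S : Matrix (Fin n) (Fin n) L).det = 0) → ∀ s h, Ec₁ S s h = 0)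
    (hd₁ : ∀ S (h : HA L e dV hdV dW hdW), DifferentiableOn ℂ (fun s => Ec₁ S s h) {s : ℂ | 0 < s.re})
    (hc₁ : ∀ S (s : ℂ), 0 < s.re → Continuous (Ec₁ S s))
    (hcoef₁ : ∀ (S : skewMatrices ((IsCMField.complexConj L : L ≃ₐ[Fp L] L) : L →+* L) ((gramR L e dV hdV dW hdW).map (algebraMap (Fp L) L))), (S : Matrix (Fin n) (Fin n) L) ≠ 0 → (S : Matrix (Fin n) (Fin n) L).det = 0 →
      ∀ (s : ℂ) (h : HA L e dV hdV dW hdW), (n : ℝ) / 2 < s.re →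
        Ec₁ S s h = (∏ p ∈ P, (s - p)) * fourierCoeffDelta L e dV hdV dW hdW νN β (S : Matrix (Fin n) (Fin n) L) (eisensteinFamilyDelta L e dV hdV dW hdW f s) h)
    (hmaj₁ : ∀ z : ℂ, 0 < z.re → ∀ h₀ : HA L e dV hdV dW hdW, ∃ r > (0 : ℝ), ∃ V ∈ 𝓝 h₀,
      ∃ m : skewMatrices ((IsCMField.complexConj L : L ≃ₐ[Fp L] L) : L →+* L) ((gramR L e dV hdV dW hdW).map (algebraMap (Fp L) L)) → ℝ, Summable m ∧ ∀ s : ℂ, dist s z < r → ∀ h ∈ V, ∀ S, ‖Ec₁ S s h‖ ≤ m S)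
    (hgr₁ : ∀ z : ℂ, 0 < z.re → ∃ C A r : ℝ, 0 < r ∧ ∀ s : ℂ, dist s z < r → ∀ h : HA L e dV hdV dW hdW,
      (Summable fun S => ‖Ec₁ S s h‖) ∧ ∑' S, ‖Ec₁ S s h‖ ≤ C * adelicHeightGL (n + n) L (h : GL (Fin (n + n)) (AdeleRing (𝓞 L) L)) ^ A)
    (EcW : skewMatrices ((IsCMField.complexConj L : L ≃ₐ[Fp L] L) : L →+* L) ((gramR L e dV hdV dW hdW).map (algebraMap (Fp L) L)) → ℂ → HA L e dV hdV dW hdW → ℂ)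
    (hWoff : ∀ S : skewMatrices ((IsCMField.complexConj L : L ≃ₐ[Fp L] L) : L →+* L) ((gramR L e dV hdV dW hdW).map (algebraMap (Fp L) L)), (S : Matrix (Fin n) (Fin n) L).det = 0 → ∀ s h, EcW S s h = 0)
    (hWd : ∀ S (h : HA L e dV hdV dW hdW), DifferentiableOn ℂ (fun s => EcW S s h) {s : ℂ | 0 < s.re})
    (hWc : ∀ S (s : ℂ), 0 < s.re → Continuous (EcW S s))
    (hWcoef : ∀ (S : skewMatrices ((IsCMField.complexConj L : L ≃ₐ[Fp L] L) : L →+* L) ((gramR L e dV hdV dW hdW).map (algebraMap (Fp L) L))), (S : Matrix (Fin n) (Fin n) L).det ≠ 0 →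
      ∀ (s : ℂ) (h : HA L e dV hdV dW hdW), (n : ℝ) / 2 < s.re →
        EcW S s h = (∏ p ∈ P, (s - p)) * fourierCoeffDelta L e dV hdV dW hdW νN β (S : Matrix (Fin n) (Fin n) L) (eisensteinFamilyDelta L e dV hdV dW hdW f s) h)
    (hWmaj : ∀ z : ℂ, 0 < z.re → ∀ h₀ : HA L e dV hdV dW hdW, ∃ r > (0 : ℝ), ∃ V ∈ 𝓝 h₀,
      ∃ m : skewMatrices ((IsCMField.complexConj L : L ≃ₐ[Fp L] L) : L →+* L) ((gramR L e dV hdV dW hdW).map (algebraMap (Fp L) L)) → ℝ, Summable m ∧ ∀ s : ℂ, dist s z < r → ∀ h ∈ V, ∀ S, ‖EcW S s h‖ ≤ m S)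
    (hWgr : ∀ z : ℂ, 0 < z.re → ∃ C A r : ℝ, 0 < r ∧ ∀ s : ℂ, dist s z < r → ∀ h : HA L e dV hdV dW hdW,
      (Summable fun S => ‖EcW S s h‖) ∧ ∑' S, ‖EcW S s h‖ ≤ C * adelicHeightGL (n + n) L (h : GL (Fin (n + n)) (AdeleRing (𝓞 L) L)) ^ A) :
    ∃ Es : ℂ → HA L e dV hdV dW hdW → ℂ,
      (∀ h : HA L e dV hdV dW hdW, DifferentiableOn ℂ (fun s => Es s h) {s : ℂ | 0 < s.re}) ∧
      (∀ s : ℂ, 0 < s.re → Continuous (Es s)) ∧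
      (∀ s : ℂ, 0 < s.re → ∀ (γ : ratH L e dV hdV dW hdW) (h : HA L e dV hdV dW hdW),
        Es s ((γ : HA L e dV hdV dW hdW) * h) = Es s h) ∧
      (∀ (s : ℂ) (h : HA L e dV hdV dW hdW), (n : ℝ) / 2 < s.re →
        Es s h = (∏ p ∈ P, (s - p)) * eisensteinFamilyDelta L e dV hdV dW hdW f s h) ∧
      (∀ z : ℂ, 0 < z.re → ∃ C A r : ℝ, 0 < r ∧ ∀ s : ℂ, dist s z < r → ∀ h : HA L e dV hdV dW hdW,
        ‖Es s h‖ ≤ C * adelicHeightGL (n + n) L (h : GL (Fin (n + n)) (AdeleRing (𝓞 L) L)) ^ A) := by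
  have hn : 0 < n := by
    have h2 : Fintype.card (Fin 2 × Fin 1) = Fintype.card (Fin n) := Fintype.card_congr e
    simp only [Fintype.card_prod, Fintype.card_fin] at h2
    omega
  obtain ⟨mfl, hmfl, hfloor⟩ := exists_height_floor L e dV hdV dW hdW hn
  have hHpos : ∀ h : HA L e dV hdV dW hdW, 0 < adelicHeightGL (n + n) L (h : GL (Fin (n + n)) (AdeleRing (𝓞 L) L)) :=
    fun h => hmfl.trans_le (hfloor h)
  refine siegelEisensteinContinuation_of_rows_poleSet L e dV hdV hdV0 dW hdW hdW0 lam hlam hw 𝒦 h𝒦 f hstd hcont νN β hβ hβ0 hβtop P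
    (fun (S : skewMatrices ((IsCMField.complexConj L : L ≃ₐ[Fp L] L) : L →+* L) ((gramR L e dV hdV dW hdW).map (algebraMap (Fp L) L))) s h => (if (S : Matrix (Fin n) (Fin n) L) = 0 then Ec₀ s h else 0) + Ec₁ S s h + EcW S s h) ?_ ?_ ?_ ?_ ?_
  · intro S h
    have h0 : DifferentiableOn ℂ (fun s => if (S : Matrix (Fin n) (Fin n) L) = 0 then Ec₀ s h else 0) {s : ℂ | 0 < s.re} := by
      split_ifs
      · exact hd₀ h
      · exact differentiableOn_const 0
    exact (h0.add (hd₁ S h)).add (hWd S h)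
  · intro S s hs
    have h0 : Continuous fun h => if (S : Matrix (Fin n) (Fin n) L) = 0 then Ec₀ s h else 0 := by
      split_ifs
      · exact hc₀ s hs
      · exact continuous_const
    exact (h0.add (hc₁ S s hs)).add (hWc S s hs)
  · intro S s h hs
    by_cases hS0 : (S : Matrix (Fin n) (Fin n) L) = 0
    · have hdet : (S : Matrix (Fin n) (Fin n) L).det = 0 := by
        haveI : Nonempty (Fin n) := ⟨⟨0, hn⟩⟩
        rw [hS0]; exact Matrix.det_zero
      rw [if_pos hS0, h1off S (fun hh => hh.1 hS0) s h, hWoff S hdet s h, add_zero, add_zero, hcoef₀ s h hs, hS0]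
    · by_cases hdet : (S : Matrix (Fin n) (Fin n) L).det = 0
      · rw [if_neg hS0, hWoff S hdet s h, zero_add, add_zero]
        exact hcoef₁ S hS0 hdet s h hs
      · rw [if_neg hS0, h1off S (fun hh => hdet hh.2) s h, zero_add, zero_add]
        exact hWcoef S hdet s h hs
  · exact majorant_of_kinds L e dV hdV dW hdW Ec₀ Ec₁ EcW hbd₀ hmaj₁ hWmaj
  · exact growth_of_kinds L e dV hdV dW hdW (fun h : HA L e dV hdV dW hdW => adelicHeightGL (n + n) L (h : GL (Fin (n + n)) (AdeleRing (𝓞 L) L)))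
      hHpos hmfl hfloor Ec₀ Ec₁ EcW hgr₀ hgr₁ hWgr

end Top3b

end Summit.HodgeConjecture.HodgeConjecture.Cruxes.HLiu418.K2LiuSiegelEisensteinContinuationPoleSet

end
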